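import Literature.MathematicalPhysics.QuantumFieldTheory.Balaban1983to89.B9Eq319BumpSectionLaplacianBackground
import Literature.MathematicalPhysics.QuantumFieldTheory.Balaban1983to89.B9Eq384RemainderLetters

/-!
# `Balaban1983to89.B9Eq319BumpSectionBackgroundExact` — T. Bałaban, *Propagators for lattice gauge theories in a background field*, Commun. Math. Phys.
# **99** (1985) 389–434 [Balaban1985BackgroundPropagators] (3.19) p. 393, (3.23) p. 394, (3.35) p. 396, Cor. 3.6 p. 408 with (3.87)–(3.89) p. 409:
# **AN EXACT SECTION OF THE BACKGROUND AVERAGING `Q′(U)` WITH ITS LAPLACIAN LETTER — the transport-free bump section `Ψ` has `Q′(U)Ψ = 1 + E` with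
# `‖E‖ ≤ ρ′(ε₁)·M_φ` (`ρ′ = (1+ε₁)^{d(L−1)} − 1`, the (ρ′) Lipschitz letter of `Q′` in the bond window; the `L²` weights cancel exactly), so
# `Ψ_U := Ψ∘(1 + E)⁻¹` satisfies `Q′(U)Ψ_U = 1` and `‖Δ^η_U(Ψ_Ug)‖ ≤ (1 − 3^dρ′)⁻¹·(d(3∕2)^d9π²2^{d−1} + d3^d(L²ε₂) + d(3∕2)^d6π2^{d−1}(Lε₁))·‖g‖`**
# — the `hΨ`∕`hCΨ` letters of `B9Eq387CubeLocalisedProjection.norm_sub_projR_cube_le(_weighted)` INHABITED AT A BACKGROUND in the small-bond window, the two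
# transport letters (ε₁) bond window, (ε₂) collinear consecutive bonds DISPLAYED (sequel of `B9Eq319BumpSectionLaplacianBackground`, which supplies the Laplacian half)

statement-level skeleton of published theorems with citation tags; proofs where landed; nothing here is a claim about the Yang–Mills mass gap

CITATION HEADER (lean-in-tree rule).  Audit cell `pub-balaban`, sub-cell `t4`, BINDER row NE9; filed by NE9 formalisation-swarm LEAF PROVER 05
(`b2b-balaban-t4-ne9-formalise-leaf-05`, gen 76), route R2′ STEP B8′ S-P6′(β) (ROUTES-NE9 §L1.2; t4-ne9-idea-1 W-(P-CΨ)).  Sources READ: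
[Balaban1985BackgroundPropagators] p. 393 (3.19) *«(Q′(U)λ)(y) = Σ_{x∈B(y)} L^{−d} R(U(Γ_{y,x}))λ(x)»* (block averaging with contour transporters — at a background
the transport-free section is NOT an exact right inverse: `Q′(U)(φ·g∘ȳ)(y) = g(y) + L^{−d}Σ_x φ(x)(R(U(Γ_{y,x})) − 1)g(y)`), p. 394 (3.23), p. 396 (3.35) (the class
in which the bond window `ε₁ = O(αη)` makes `ρ′ = O(dα)` on the proper scale — a READING, not typed), p. 408 Cor. 3.6, p. 409 (3.87)–(3.89).  A bump section
is the CHAIN's device (ROUTES-NE9 kernels 5∕6), NOT print's (random-walk expansions); NOTHING of print's estimates is asserted.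

WHY.  S-P6′(β) `norm_sub_projR_cube_le` wants `hΨ : Q′Ψ = 1` EXACTLY (the truncated minimiser is corrected by `Ψ[Q′, θ]λ₀`); the previous file bounds
`Δ_U` of the transport-free section `Ψ`, whose averaging defect `E = (Q′(U) − Q′(1))Ψ` is small by the (ρ′) letter; a near-identity on a finite-dimensional
space is inverted by injectivity alone, and `Ψ_U = Ψ∘(1 + E)⁻¹` inherits the Laplacian letter with the factor `(1 − ‖E‖)⁻¹`.

WHAT IS PROVED (sorry-free; proof lane — no `def`; [folklore] finite sums + finite-dimensional invertibility + one free ring identity BY NAME over the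
(ρ′) file, gen 75's flat section identity, the previous file's §4–§5 and `B9Eq384RemainderLetters.norm_adTransportW_sub_le`).
* §1 **`norm_QprimeW_section_sub_apply_le`** (POINTWISE: `‖Q′(U)(Ψh)(y) − h(y)‖ ≤ ρ′(ε)·M_φ·‖h(y)‖`) and **`norm_QprimeW_section_sub_le`** (`L²(c₁)`:
  `‖Q′(U)(Ψg) − g‖ ≤ ρ′·M_φ·‖g‖`; the weights `c₀`, `c₁`, `L^d` cancel exactly) — the exactness defect at the printed transporters `R(U(b))` read on the
  fibre along `φ_A`, `ρ′ = (1+ε)^{d(L−1)} − 1` (`B9Eq319QprimeLipschitz` (ρ′) + `QprimeW_one_section` + `norm_section_le`).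
* §2 `adTransportW_inv_apply_adTransportW` (the `hSR` letter at `R(U(b))`, `R(U(b)⁻¹)`), `linearEquiv_symm_eq_of_pointwise` (clause (i) ⇒ the consumer's
  `Q′(Ψ_Ug) = g` in `L²(c₁)`), **`exists_bump_section_background`** — the package: for `L ≥ 3`,
  `Lη = 1`, `c₁ = c₀L^d`, under (ε₁) on `R(U(b)^{±1})`, (ε₂), and `3^d·ρ′(ε₁) < 1`: `∃ Ψ_U` linear with (i) `Q′(U)(Ψ_Ug)(y) = g(y)` at every coarse site,
  (ii) BLOCK-LOCALITY `g(y) = 0 ⇒ (Ψ_Ug)(x) = 0` on the block `ȳ(x) = y` (the `hΨN` letter of S-P6′(β): the fibrewise defect is a strict contraction, so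
  `(Q′(U)Ψ)⁻¹` preserves zeros), (iii) `‖Δ^η_U(Ψ_Ug)‖ ≤ (1 − 3^dρ′)⁻¹·(d(3∕2)^d9π²2^{d−1} + d3^d(L²ε₂) + d(3∕2)^d6π2^{d−1}(Lε₁))·‖g‖`.
* §3 THE LETTERS FROM THE UNIT WINDOWS: `invConj_add_conj_sub_eq` (free ring identity, second order), `two_sub_sub_inv_eq`,
  **`norm_invConj_add_conj_sub_le`** (`‖(v⁻¹Xv − X) + (uXu⁻¹ − X)‖ ≤ (2‖u − v‖ + 4ε²)‖X‖` in the windows), **`norm_adTransportW_pair_sub_le`** (on the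
  fibre: `≤ M_φ′M_φ(2‖U(b) − U(b′)‖ + 4ε²)‖w‖` for `U(b), U(b′) ∈ U1` in the window `ε`).
* §4 **`exists_bump_section_background_unitWindow`** — the same three conclusions in `B9Eq387IMSAssemblyLattice`'s letters (`hφ`, `hφ′`, `U(b) ∈ U1`,
  `‖U(b) − 1‖ ≤ ε`) plus ONE new displayed letter, the COLLINEAR-BOND letter `‖U(x, μ) − U(x − e_μ, μ)‖ ≤ β₂` (print's `|∇^ηA|η²` in the gauge of (3.35)),
  in the window `3^d·ρ′(2M_φM_φ′ε) < 1`; `ε₁ := 2M_φM_φ′ε`, `ε₂ := M_φ′M_φ(2β₂ + 4ε²)`; on the proper scale (`ε = αη`, `β₂ = βη²`, `Lη = 1`) every `L` cancels.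
  (In print's exponential gauge `U(b) = e^{iηA(b)}` of (3.35) the two unit letters come from the lit-balaban cell's `B9Eq335Plaquette.hyps_of_335` —
  `‖iηA_b‖ ≤ C′ξ`, `‖iηA_b − iηA_{b′}‖ ≤ C′ξ²` — and `norm_exp_sub_one_le_mul` ∕ `norm_exp_sub_exp_le_of_le`: `ε = C′ξe^{C′ξ}`, `β₂ = C′ξ²e^{C′ξ}`; NOT
  imported here — the letters stay displayed.)
HONEST SCOPE.  ONE averaging step (`Q′` of (3.19)), NOT the composite `Q′_k`; the fibre reading `φ_A` is FIXED (the transporters depend on it); transport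
letters DISPLAYED, not discharged; the smallness `3^dρ′ < 1` is a WINDOW on `ε₁` (`ρ′ ≈ d(L−1)ε₁`), no number evaluated; no cut-off `θ`, no weights, no
minimiser — ONE letter of ONE sub-step of a route step, NOT NE9 (cell pub-balaban: NE9 NOT PRINTED ∕ NOT PROVED; «NE9 ⇐ the named binders»; row WALLED ON A
MODEL (O-NE9-1; #5 UNRULED); spine PROVED 0∕9; rung (B)+1 on a finite T⁴ — NOT infinite volume, NOT mass gap, NOT BetaPertH, NOT Clay; HONEST DEPENDENCY:
continuum YM on T⁴ ⇐ BetaPertH ∧ nine spine estimates (0/9 proved); BetaPertH ⇐ (D1) ∧ (D4) ∧ CAP+tail; G-an2-4 gates asym, D1 and NE2/3/4).  NEW file; imports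
`B9Eq319BumpSectionLaplacianBackground` + `B9Eq384RemainderLetters` (the unit-window transporter letter); nothing modified.  Net new unproved facts: 0.
-/

noncomputable section

open scoped InnerProductSpace BigOperators

namespace Literature.MathematicalPhysics.QuantumFieldTheory.Balaban1983to89.B9Eq319BumpSectionBackgroundExact

open B4Sect5Torus (TSite)
open B9SectCLatticeCarrier (Bond unshift)
open B9Eq311L2Pairing (WL2)
open B11Eq103H1Complex (SiteL2K covLaplaceSiteK)
open B9Eq310HessianOperator (adTransportW adTransportW_apply)
open B9Eq319QprimeTorus (fineP blockCoord mem_blockOf_iff)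
open B5Eq172FlatCoercivity (card_blockOf)
open B9Eq319QprimeLipschitz (sum_norm_sq_QprimeW_sub_flat_le norm_QprimeW_sub_flat_apply_le rho_nonneg)
open B9Eq326OperatorAssembly (QprimeW)
open B9Eq319BumpProfileCos (exists_bumpProfileCos bumpProfileCos_const_le)
open B9Eq319BumpSectionLaplacianFlat (QprimeW_one_section)
open B9Eq319BumpSectionLaplacianBackground (norm_section_le norm_covLaplaceSiteK_section_transport_le_diagonal exists_inverse_of_norm_sub_le)

variable {d : ℕ} (L : ℕ) [NeZero L] (m : Fin d → ℕ)
  {W : Type*} [NormedAddCommGroup W] [InnerProductSpace ℂ W]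

/-! ## §1 The exactness defect `Q′(U)Ψ − 1` at the printed transporters -/

section Defect

variable {𝔸 : Type*} [NormedRing 𝔸] [NormedAlgebra ℂ 𝔸] (φA : W ≃ₗ[ℂ] 𝔸)
  {c₀ c₁ : ℝ} [Fact (0 < c₀)] [Fact (0 < c₁)]
  {φ : TSite d (fineP L m) → ℝ} (hsum : ∀ y : TSite d m, ∑ x ∈ B9Eq319QprimeTorus.blockOf L m y, ((L : ℝ) ^ d)⁻¹ * φ x = 1)
  {Ψ : SiteL2K ℂ d m c₁ W →ₗ[ℂ] SiteL2K ℂ d (fineP L m) c₀ W}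
  (hΨ : ∀ (g : SiteL2K ℂ d m c₁ W) (x : TSite d (fineP L m)),
    WL2.equiv ℂ _ W (Ψ g) x = ((φ x : ℝ) : ℂ) • WL2.equiv ℂ _ W g (blockCoord L m x))
  (U : Bond d (fineP L m) → 𝔸ˣ)

include hsum hΨ

omit [Fact (0 < c₀)] [Fact (0 < c₁)] in
/-- **THE EXACTNESS DEFECT, POINTWISE**: `‖Q′(U)(Ψh)(y) − h(y)‖ ≤ ρ′·M_φ·‖h(y)‖` — `h(y) = Q′(1)(Ψh)(y)`, the (ρ′) letter in block form, and
`L^{−d}Σ_{x∈B(y)}‖(Ψh)(x)‖ ≤ M_φ‖h(y)‖`.  The fibrewise defect is a strict contraction once `ρ′M_φ < 1`. [cite: Balaban1985BackgroundPropagators, (3.19) p.393, p.403] -/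
theorem norm_QprimeW_section_sub_apply_le [∀ i, NeZero (fineP L m i)] {Mφ ε : ℝ} (hφM : ∀ y, |φ y| ≤ Mφ) (hε : 0 ≤ ε)
    (hR : ∀ b w, ‖adTransportW φA U b w - w‖ ≤ ε * ‖w‖) (h : SiteL2K ℂ d m c₁ W) (y : TSite d m) :
    ‖QprimeW L m φA U (c₀ := c₀) (Ψ h) y - WL2.equiv ℂ _ W h y‖ ≤ ((1 + ε) ^ (d * (L - 1)) - 1) * Mφ * ‖WL2.equiv ℂ _ W h y‖ := by
  have hρ := rho_nonneg L (d := d) hε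
  have hL0 : (0 : ℝ) < (L : ℝ) ^ d := by
    have : (0 : ℝ) < L := Nat.cast_pos.2 (Nat.pos_of_ne_zero (NeZero.ne L))
    positivity
  have e : QprimeW L m φA U (c₀ := c₀) (Ψ h) y - WL2.equiv ℂ _ W h y =
      QprimeW L m φA U (c₀ := c₀) (Ψ h) y - QprimeW L m φA (fun _ => 1) (c₀ := c₀) (Ψ h) y := by
    rw [QprimeW_one_section L m φA hsum hΨ h y]
  rw [e]
  refine (norm_QprimeW_sub_flat_apply_le L m φA U hε hR (Ψ h) y).trans ?_
  rw [mul_assoc]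
  refine mul_le_mul_of_nonneg_left ?_ hρ
  have hx : ∀ x ∈ B9Eq319QprimeTorus.blockOf L m y,
      ‖WL2.linearEquiv ℂ ℂ (fun _ : TSite d (fineP L m) => c₀) (Ψ h) x‖ ≤ Mφ * ‖WL2.equiv ℂ _ W h y‖ := fun x hx => by
    rw [WL2.linearEquiv_apply, hΨ, (mem_blockOf_iff L m y x).1 hx, norm_smul, Complex.norm_real, Real.norm_eq_abs]
    exact mul_le_mul_of_nonneg_right (hφM x) (norm_nonneg _)
  calc ((L : ℝ) ^ d)⁻¹ * ∑ x ∈ B9Eq319QprimeTorus.blockOf L m y, ‖WL2.linearEquiv ℂ ℂ (fun _ : TSite d (fineP L m) => c₀) (Ψ h) x‖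
      ≤ ((L : ℝ) ^ d)⁻¹ * ∑ _x ∈ B9Eq319QprimeTorus.blockOf L m y, Mφ * ‖WL2.equiv ℂ _ W h y‖ :=
        mul_le_mul_of_nonneg_left (Finset.sum_le_sum hx) (by positivity)
    _ = Mφ * ‖WL2.equiv ℂ _ W h y‖ := by
        rw [Finset.sum_const, card_blockOf, nsmul_eq_mul, Nat.cast_pow]; field_simp

/-- **THE EXACTNESS DEFECT IS SMALL**: under the transporter window `‖R(U(b))w − w‖ ≤ ε‖w‖`, `‖Q′(U)(Ψg) − g‖_{L²(c₁)} ≤ ρ′·M_φ·‖g‖_{L²(c₁)}` with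
`ρ′ = (1 + ε)^{d(L−1)} − 1` — `Q′(U)(Ψg) − g = (Q′(U) − Q′(1))(Ψg)` by `Q′(1)Ψ = 1`, the (ρ′) letter in Hilbert currency, and `‖Ψg‖ ≤ M_φ√(c₀L^d∕c₁)‖g‖`
(the weights cancel exactly). [cite: Balaban1985BackgroundPropagators, (3.19) p.393, p.403, (3.11) p.392] -/
theorem norm_QprimeW_section_sub_le [∀ i, NeZero (fineP L m i)] {Mφ ε : ℝ} (hM0 : 0 ≤ Mφ) (hφM : ∀ y, |φ y| ≤ Mφ) (hε : 0 ≤ ε)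
    (hR : ∀ b w, ‖adTransportW φA U b w - w‖ ≤ ε * ‖w‖) (g : SiteL2K ℂ d m c₁ W) :
    ‖(WL2.linearEquiv ℂ ℂ (fun _ : TSite d m => c₁)).symm (QprimeW L m φA U (c₀ := c₀) (Ψ g)) - g‖ ≤
      ((1 + ε) ^ (d * (L - 1)) - 1) * Mφ * ‖g‖ := by
  have hc₀ : 0 < c₀ := Fact.out
  have hc₁ : 0 < c₁ := Fact.out
  have hρ := rho_nonneg L (d := d) hε
  set ρ : ℝ := (1 + ε) ^ (d * (L - 1)) - 1 with hρdef
  clear_value ρ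
  -- the square of the left side, coordinatewise
  have hsq0 : ‖(WL2.linearEquiv ℂ ℂ (fun _ : TSite d m => c₁)).symm (QprimeW L m φA U (c₀ := c₀) (Ψ g)) - g‖ ^ 2 =
      c₁ * ∑ y, ‖QprimeW L m φA U (c₀ := c₀) (Ψ g) y - QprimeW L m φA (fun _ => 1) (c₀ := c₀) (Ψ g) y‖ ^ 2 := by
    rw [WL2.norm_sq (𝕜 := ℂ) (w := fun _ : TSite d m => c₁) (V := W), Finset.mul_sum]
    refine Finset.sum_congr rfl fun y _ => ?_
    congr 2
    rw [WL2.equiv_sub, Pi.sub_apply, QprimeW_one_section L m φA hsum hΨ g y, WL2.linearEquiv_symm_apply, Equiv.apply_symm_apply]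
  have hΨn : ‖Ψ g‖ ≤ Mφ * Real.sqrt (c₀ * (L : ℝ) ^ d / c₁) * ‖g‖ := norm_section_le L m hΨ hM0 hφM g
  have hr : Real.sqrt (c₀ * (L : ℝ) ^ d / c₁) ^ 2 = c₀ * (L : ℝ) ^ d / c₁ := Real.sq_sqrt (by positivity)
  have hsq : ‖(WL2.linearEquiv ℂ ℂ (fun _ : TSite d m => c₁)).symm (QprimeW L m φA U (c₀ := c₀) (Ψ g)) - g‖ ^ 2 ≤ (ρ * Mφ * ‖g‖) ^ 2 := by
    rw [hsq0]
    calc c₁ * ∑ y, ‖QprimeW L m φA U (c₀ := c₀) (Ψ g) y - QprimeW L m φA (fun _ => 1) (c₀ := c₀) (Ψ g) y‖ ^ 2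
        ≤ c₁ * (ρ ^ 2 * (((L : ℝ) ^ d * c₀)⁻¹ * ‖Ψ g‖ ^ 2)) := by
          refine mul_le_mul_of_nonneg_left ?_ hc₁.le
          rw [hρdef]
          exact sum_norm_sq_QprimeW_sub_flat_le L m φA U hε hR (Ψ g)
      _ ≤ c₁ * (ρ ^ 2 * (((L : ℝ) ^ d * c₀)⁻¹ * (Mφ * Real.sqrt (c₀ * (L : ℝ) ^ d / c₁) * ‖g‖) ^ 2)) := by
          gcongr
      _ = (ρ * Mφ * ‖g‖) ^ 2 := by
          have hL0 : (0 : ℝ) < L := Nat.cast_pos.2 (Nat.pos_of_ne_zero (NeZero.ne L))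
          rw [mul_pow, mul_pow, hr]; field_simp
  have h0 : 0 ≤ ρ * Mφ * ‖g‖ := by positivity
  exact (pow_le_pow_iff_left₀ (norm_nonneg _) h0 two_ne_zero).1 hsq

end Defect

/-! ## §2 The package: an exact, block-local section of `Q′(U)` with its Laplacian letter, transport letters displayed -/

section Package

variable {𝔸 : Type*} [NormedRing 𝔸] [NormedAlgebra ℂ 𝔸]
  {c₀ c₁ : ℝ} [Fact (0 < c₀)] [Fact (0 < c₁)]

omit [NeZero L] [Fact (0 < c₀)] [Fact (0 < c₁)] in
/-- `R(U(b)⁻¹)(R(U(b))w) = w` on the Hilbert fibre: the `hSR` letter of `B9Eq319BumpSectionLaplacianBackground` §1 at the printed transporters. [cite: Balaban1985BackgroundPropagators, p.390, (3.8) p.392] -/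
theorem adTransportW_inv_apply_adTransportW {Pd : Fin d → ℕ} (φA : W ≃ₗ[ℂ] 𝔸) (U : Bond d Pd → 𝔸ˣ) (b : Bond d Pd) (w : W) :
    adTransportW φA (fun b => (U b)⁻¹) b (adTransportW φA U b w) = w := by
  rw [adTransportW_apply, adTransportW_apply, LinearEquiv.apply_symm_apply, inv_inv]
  have e : ((U b)⁻¹ : 𝔸ˣ) * ((U b : 𝔸) * φA w * ((U b)⁻¹ : 𝔸ˣ)) * (U b : 𝔸) = φA w := by
    rw [← mul_assoc, ← mul_assoc, Units.inv_mul, one_mul, mul_assoc, Units.inv_mul, mul_one]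
  rw [e, LinearEquiv.symm_apply_apply]

omit [NeZero L] [Fact (0 < c₀)] [Fact (0 < c₁)] in
/-- From the pointwise exactness clause to the consumer's `hΨ : Q′(Ψg) = g` in `L²(c₁)`: a coarse function is determined by its values. [folklore]
[cite: Balaban1985BackgroundPropagators, (3.19) p.393, (3.11) p.392] -/
theorem linearEquiv_symm_eq_of_pointwise (F : TSite d m → W) (g : SiteL2K ℂ d m c₁ W) (h : ∀ y, F y = WL2.equiv ℂ _ W g y) :
    (WL2.linearEquiv ℂ ℂ (fun _ : TSite d m => c₁)).symm F = g := by
  rw [WL2.linearEquiv_symm_apply, Equiv.symm_apply_eq]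
  exact funext h

/-- **THE BUMP SECTION AT A BACKGROUND, EXACT, WITH ITS LAPLACIAN LETTER**: for `L ≥ 3`, `Lη = 1`, `c₁ = c₀L^d`, a background `U` read on the fibre
along `φ_A` whose transporters `R(U(b))`, `R(U(b)⁻¹)` obey the bond window (ε₁) and the collinear-bond letter (ε₂), and `3^d·ρ′(ε₁) < 1`
(`ρ′ = (1+ε₁)^{d(L−1)} − 1`): there is a `ℂ`-linear `Ψ_U : L²(T_m; c₁) → L²(T_{Lm}; c₀)` with (i) `Q′(U)(Ψ_Ug) = g` at every coarse site, (ii) BLOCK-LOCALITY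
`g(y) = 0 ⇒ (Ψ_Ug)(x) = 0` for `ȳ(x) = y`, and (iii) `‖Δ^η_U(Ψ_Ug)‖ ≤ (1 − 3^dρ′)⁻¹·(d(3∕2)^d9π²2^{d−1} + d3^d(L²ε₂) + d(3∕2)^d6π2^{d−1}(Lε₁))·‖g‖` — the
`hΨ`∕`hΨN`∕`hCΨ` letters of `B9Eq387CubeLocalisedProjection.norm_sub_projR_cube_le` at a background (`Ψ_U = Ψ∘(Q′(U)Ψ)⁻¹`, `Ψ` the cosine-bump section; (ii)
because the fibrewise defect `‖Q′(U)(Ψh)(y) − h(y)‖ ≤ 3^dρ′‖h(y)‖` is a strict contraction).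
[cite: Balaban1985BackgroundPropagators, (3.19) p.393, (3.23) p.394, (3.35) p.396, Cor 3.6 p.408, (3.89) p.409] -/
theorem exists_bump_section_background [∀ i, NeZero (fineP L m i)] [FiniteDimensional ℂ W] (hL : 3 ≤ L) {η : ℝ} (hLη : (L : ℝ) * η = 1)
    (hc : c₀ * (L : ℝ) ^ d = c₁) (φA : W ≃ₗ[ℂ] 𝔸) (U : Bond d (fineP L m) → 𝔸ˣ) {ε₁ ε₂ : ℝ} (hε₁ : 0 ≤ ε₁) (hε₂ : 0 ≤ ε₂)
    (hR1 : ∀ b w, ‖adTransportW φA U b w - w‖ ≤ ε₁ * ‖w‖) (hS1 : ∀ b w, ‖adTransportW φA (fun b => (U b)⁻¹) b w - w‖ ≤ ε₁ * ‖w‖)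
    (h2 : ∀ (y : TSite d (fineP L m)) (μ : Fin d) (w : W),
      ‖(adTransportW φA (fun b => (U b)⁻¹) (unshift μ y, μ) w - w) + (adTransportW φA U (y, μ) w - w)‖ ≤ ε₂ * ‖w‖)
    (hq : 3 ^ d * ((1 + ε₁) ^ (d * (L - 1)) - 1) < 1) :
    ∃ ΨU : SiteL2K ℂ d m c₁ W →ₗ[ℂ] SiteL2K ℂ d (fineP L m) c₀ W,
      (∀ (g : SiteL2K ℂ d m c₁ W) (y : TSite d m), QprimeW L m φA U (c₀ := c₀) (ΨU g) y = WL2.equiv ℂ _ W g y) ∧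
      (∀ (g : SiteL2K ℂ d m c₁ W) (y : TSite d m), WL2.equiv ℂ _ W g y = 0 →
          ∀ x : TSite d (fineP L m), blockCoord L m x = y → WL2.equiv ℂ _ W (ΨU g) x = 0) ∧
      (∀ g : SiteL2K ℂ d m c₁ W,
          ‖covLaplaceSiteK ((η : ℂ))⁻¹ (adTransportW φA U) (adTransportW φA (fun b => (U b)⁻¹)) (ΨU g)‖ ≤
            (1 - 3 ^ d * ((1 + ε₁) ^ (d * (L - 1)) - 1))⁻¹ *
              (d * (3 / 2 : ℝ) ^ d * (9 * Real.pi ^ 2) * 2 ^ (d - 1) + d * 3 ^ d * ((L : ℝ) ^ 2 * ε₂) +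
                d * (3 / 2 : ℝ) ^ d * (6 * Real.pi) * 2 ^ (d - 1) * ((L : ℝ) * ε₁)) * ‖g‖) := by
  obtain ⟨φ, hsum, hℓ₁, hφM, -, hcross, hℓ₂⟩ := exists_bumpProfileCos (d := d) L m hL
  obtain ⟨-, -, hM3⟩ := bumpProfileCos_const_le (d := d) L hL
  have h3 : (3 : ℝ) ≤ L := by exact_mod_cast hL
  have hL1 : (0 : ℝ) < (L : ℝ) - 1 := by linarith
  have hM0 : 0 ≤ ((L : ℝ) / ((L : ℝ) - 1)) ^ d * 2 ^ d := by positivity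
  -- the transport-free section, as in the flat file
  let E : (TSite d m → W) →ₗ[ℂ] (TSite d (fineP L m) → W) :=
    LinearMap.pi fun x : TSite d (fineP L m) => ((φ x : ℝ) : ℂ) • LinearMap.proj (R := ℂ) (φ := fun _ : TSite d m => W) (blockCoord L m x)
  let Ψ : SiteL2K ℂ d m c₁ W →ₗ[ℂ] SiteL2K ℂ d (fineP L m) c₀ W :=
    (WL2.linearEquiv ℂ ℂ (fun _ : TSite d (fineP L m) => c₀)).symm.toLinearMap ∘ₗ E ∘ₗ
      (WL2.linearEquiv ℂ ℂ (fun _ : TSite d m => c₁)).toLinearMap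
  have hΨ : ∀ (g : SiteL2K ℂ d m c₁ W) (x : TSite d (fineP L m)),
      WL2.equiv ℂ _ W (Ψ g) x = ((φ x : ℝ) : ℂ) • WL2.equiv ℂ _ W g (blockCoord L m x) := fun g x => rfl
  -- `T = Q′(U)Ψ` read back on `L²(c₁)`, a near-identity
  let T : SiteL2K ℂ d m c₁ W →ₗ[ℂ] SiteL2K ℂ d m c₁ W :=
    (WL2.linearEquiv ℂ ℂ (fun _ : TSite d m => c₁)).symm.toLinearMap ∘ₗ QprimeW L m φA U (c₀ := c₀) ∘ₗ Ψ
  have hρ := rho_nonneg L (d := d) hε₁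
  have hT : ∀ v, ‖T v - v‖ ≤ 3 ^ d * ((1 + ε₁) ^ (d * (L - 1)) - 1) * ‖v‖ := fun v => by
    have h := norm_QprimeW_section_sub_le L m φA hsum hΨ U hM0 hφM hε₁ hR1 v
    refine h.trans (mul_le_mul_of_nonneg_right ?_ (norm_nonneg _))
    calc ((1 + ε₁) ^ (d * (L - 1)) - 1) * (((L : ℝ) / ((L : ℝ) - 1)) ^ d * 2 ^ d)
        ≤ ((1 + ε₁) ^ (d * (L - 1)) - 1) * 3 ^ d := mul_le_mul_of_nonneg_left hM3 hρ
      _ = 3 ^ d * ((1 + ε₁) ^ (d * (L - 1)) - 1) := mul_comm _ _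
  obtain ⟨Tinv, hTT, -, hTn⟩ := exists_inverse_of_norm_sub_le T hq hT
  -- `Q′(U)(Ψ v) = (WL2.linearEquiv)(T v)` as functions
  have eT : ∀ v, QprimeW L m φA U (c₀ := c₀) (Ψ v) = WL2.linearEquiv ℂ ℂ (fun _ : TSite d m => c₁) (T v) := fun v => by
    simp only [T, LinearMap.comp_apply, LinearEquiv.coe_toLinearMap, LinearEquiv.apply_symm_apply]
  refine ⟨Ψ ∘ₗ Tinv, fun g y => ?_, fun g y hgy x hx => ?_, fun g => ?_⟩
  · -- exactness: `Q′(U)(Ψ(T⁻¹g)) = (WL2.linearEquiv)(T(T⁻¹g)) = g`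
    rw [LinearMap.comp_apply, eT, hTT, WL2.linearEquiv_apply]
  · -- block-locality: the fibrewise defect is a strict contraction, so `(T⁻¹g)(y) = 0` whenever `g(y) = 0`
    have hq3 : ((1 + ε₁) ^ (d * (L - 1)) - 1) * (((L : ℝ) / ((L : ℝ) - 1)) ^ d * 2 ^ d) < 1 :=
      lt_of_le_of_lt ((mul_le_mul_of_nonneg_left hM3 hρ).trans_eq (mul_comm _ _)) hq
    have hpt := norm_QprimeW_section_sub_apply_le L m φA hsum hΨ U hφM hε₁ hR1 (Tinv g) y
    rw [eT, hTT, WL2.linearEquiv_apply, hgy, zero_sub, norm_neg] at hpt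
    have h0 : WL2.equiv ℂ _ W (Tinv g) y = 0 := by
      rw [← norm_le_zero_iff]
      nlinarith [norm_nonneg (WL2.equiv ℂ _ W (Tinv g) y)]
    rw [LinearMap.comp_apply, hΨ, hx, h0, smul_zero]
  · have hSR : ∀ b w, adTransportW φA (fun b => (U b)⁻¹) b (adTransportW φA U b w) = w := adTransportW_inv_apply_adTransportW φA U
    have h := norm_covLaplaceSiteK_section_transport_le_diagonal L m hcross hℓ₁ hφM hℓ₂ hΨ hLη hL hc hSR hε₁ hε₂ hR1 hS1 h2 (Tinv g)
    rw [LinearMap.comp_apply]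
    refine h.trans ?_
    have hq0 : 0 < 1 - 3 ^ d * ((1 + ε₁) ^ (d * (L - 1)) - 1) := sub_pos.2 hq
    have hC0 : 0 ≤ d * (3 / 2 : ℝ) ^ d * (9 * Real.pi ^ 2) * 2 ^ (d - 1) + d * 3 ^ d * ((L : ℝ) ^ 2 * ε₂) +
        d * (3 / 2 : ℝ) ^ d * (6 * Real.pi) * 2 ^ (d - 1) * ((L : ℝ) * ε₁) := by positivity
    calc _ ≤ (d * (3 / 2 : ℝ) ^ d * (9 * Real.pi ^ 2) * 2 ^ (d - 1) + d * 3 ^ d * ((L : ℝ) ^ 2 * ε₂) +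
          d * (3 / 2 : ℝ) ^ d * (6 * Real.pi) * 2 ^ (d - 1) * ((L : ℝ) * ε₁)) * ((1 - 3 ^ d * ((1 + ε₁) ^ (d * (L - 1)) - 1))⁻¹ * ‖g‖) :=
          mul_le_mul_of_nonneg_left (hTn g) hC0
      _ = _ := by ring

end Package

/-! ## §3 The transport letters from the unit windows and the collinear-bond letter -/

section Letters

variable {𝔸 : Type*} [NormedRing 𝔸] [NormedAlgebra ℂ 𝔸] [NormOneClass 𝔸]

omit [NormedAlgebra ℂ 𝔸] [NormOneClass 𝔸] in
/-- **THE SECOND-ORDER IDENTITY BEHIND (ε₂)** (free ring identity; `u′`, `v′` stand for `u⁻¹`, `v⁻¹`):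
`(v′Xv − X) + (uXu′ − X) = (u − v)X − X(u − v) + (u − 1)X(u′ − 1) + (v′ − 1)X(v − 1) − (2 − v − v′)X − X(2 − u − u′)` — first order in `u − v`, second
order in the windows. [folklore] [cite: Balaban1985BackgroundPropagators, (3.35) p.396, p.390] -/
theorem invConj_add_conj_sub_eq {𝔹 : Type*} [Ring 𝔹] (u u' v v' X : 𝔹) :
    (v' * X * v - X) + (u * X * u' - X) =
      (u - v) * X - X * (u - v) + (u - 1) * X * (u' - 1) + (v' - 1) * X * (v - 1) - (2 - v - v') * X - X * (2 - u - u') := by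
  noncomm_ring

omit [NormedAlgebra ℂ 𝔸] [NormOneClass 𝔸] in
/-- `2 − v − v⁻¹ = (v − 1)(v⁻¹ − 1)` for a unit. [folklore] [cite: Balaban1985BackgroundPropagators, p.390] -/
theorem two_sub_sub_inv_eq (v : 𝔸ˣ) : (2 : 𝔸) - v - ((v⁻¹ : 𝔸ˣ) : 𝔸) = ((v : 𝔸) - 1) * (((v⁻¹ : 𝔸ˣ) : 𝔸) - 1) := by
  have h : (v : 𝔸) * ((v⁻¹ : 𝔸ˣ) : 𝔸) = 1 := Units.mul_inv v
  have e : ((v : 𝔸) - 1) * (((v⁻¹ : 𝔸ˣ) : 𝔸) - 1) = (v : 𝔸) * ((v⁻¹ : 𝔸ˣ) : 𝔸) - v - ((v⁻¹ : 𝔸ˣ) : 𝔸) + 1 := by noncomm_ring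
  rw [e, h, ← one_add_one_eq_two]
  abel

omit [NormedAlgebra ℂ 𝔸] [NormOneClass 𝔸] in
/-- **(ε₂) IN THE ALGEBRA**: for units `u`, `v` in the windows `‖u − 1‖, ‖u⁻¹ − 1‖, ‖v − 1‖, ‖v⁻¹ − 1‖ ≤ ε`,
`‖(v⁻¹Xv − X) + (uXu⁻¹ − X)‖ ≤ (2‖u − v‖ + 4ε²)‖X‖` — the COLLINEAR-BOND letter `‖u − v‖` (print's `|∇^ηA|η²` in the gauge `U = e^{iηA}` of (3.35))
plus the bond window squared. [folklore] [cite: Balaban1985BackgroundPropagators, (3.35) p.396, p.390] -/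
theorem norm_invConj_add_conj_sub_le (u v : 𝔸ˣ) {ε : ℝ} (hu : ‖(u : 𝔸) - 1‖ ≤ ε) (hu' : ‖((u⁻¹ : 𝔸ˣ) : 𝔸) - 1‖ ≤ ε)
    (hv : ‖(v : 𝔸) - 1‖ ≤ ε) (hv' : ‖((v⁻¹ : 𝔸ˣ) : 𝔸) - 1‖ ≤ ε) (X : 𝔸) :
    ‖(((v⁻¹ : 𝔸ˣ) : 𝔸) * X * v - X) + ((u : 𝔸) * X * ((u⁻¹ : 𝔸ˣ) : 𝔸) - X)‖ ≤ (2 * ‖(u : 𝔸) - v‖ + 4 * ε ^ 2) * ‖X‖ := by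
  have hε : 0 ≤ ε := (norm_nonneg _).trans hu
  rw [invConj_add_conj_sub_eq, two_sub_sub_inv_eq, two_sub_sub_inv_eq]
  set δ := ‖(u : 𝔸) - v‖ with hδ
  have hA : ‖((u : 𝔸) - v) * X‖ ≤ δ * ‖X‖ := norm_mul_le _ _
  have hB : ‖X * ((u : 𝔸) - v)‖ ≤ δ * ‖X‖ := (norm_mul_le _ _).trans_eq (mul_comm _ _)
  have h3 : ∀ (a c : 𝔸), ‖a‖ ≤ ε → ‖c‖ ≤ ε → ‖a * X * c‖ ≤ ε ^ 2 * ‖X‖ := fun a c ha hc => by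
    calc ‖a * X * c‖ ≤ ‖a‖ * ‖X‖ * ‖c‖ := (norm_mul_le _ _).trans (mul_le_mul_of_nonneg_right (norm_mul_le _ _) (norm_nonneg _))
      _ ≤ ε * ‖X‖ * ε := by gcongr
      _ = ε ^ 2 * ‖X‖ := by ring
  have h3' : ∀ (a c : 𝔸), ‖a‖ ≤ ε → ‖c‖ ≤ ε → ‖a * c * X‖ ≤ ε ^ 2 * ‖X‖ := fun a c ha hc => by
    calc ‖a * c * X‖ ≤ ‖a‖ * ‖c‖ * ‖X‖ := (norm_mul_le _ _).trans (mul_le_mul_of_nonneg_right (norm_mul_le _ _) (norm_nonneg _))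
      _ ≤ ε * ε * ‖X‖ := by gcongr
      _ = ε ^ 2 * ‖X‖ := by ring
  have h3'' : ∀ (a c : 𝔸), ‖a‖ ≤ ε → ‖c‖ ≤ ε → ‖X * (a * c)‖ ≤ ε ^ 2 * ‖X‖ := fun a c ha hc => by
    calc ‖X * (a * c)‖ ≤ ‖X‖ * (‖a‖ * ‖c‖) := (norm_mul_le _ _).trans (mul_le_mul_of_nonneg_left (norm_mul_le _ _) (norm_nonneg _))
      _ ≤ ‖X‖ * (ε * ε) := by gcongr
      _ = ε ^ 2 * ‖X‖ := by ring
  have hC := h3 _ _ hu hu'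
  have hD := h3 _ _ hv' hv
  have hE := h3' _ _ hv hv'
  have hF := h3'' _ _ hu hu'
  have t1 := norm_sub_le (((u : 𝔸) - v) * X - X * ((u : 𝔸) - v) + ((u : 𝔸) - 1) * X * (((u⁻¹ : 𝔸ˣ) : 𝔸) - 1) +
      (((v⁻¹ : 𝔸ˣ) : 𝔸) - 1) * X * ((v : 𝔸) - 1) - ((v : 𝔸) - 1) * (((v⁻¹ : 𝔸ˣ) : 𝔸) - 1) * X)
    (X * (((u : 𝔸) - 1) * (((u⁻¹ : 𝔸ˣ) : 𝔸) - 1)))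
  have t2 := norm_sub_le (((u : 𝔸) - v) * X - X * ((u : 𝔸) - v) + ((u : 𝔸) - 1) * X * (((u⁻¹ : 𝔸ˣ) : 𝔸) - 1) +
      (((v⁻¹ : 𝔸ˣ) : 𝔸) - 1) * X * ((v : 𝔸) - 1)) (((v : 𝔸) - 1) * (((v⁻¹ : 𝔸ˣ) : 𝔸) - 1) * X)
  have t3 := norm_add_le (((u : 𝔸) - v) * X - X * ((u : 𝔸) - v) + ((u : 𝔸) - 1) * X * (((u⁻¹ : 𝔸ˣ) : 𝔸) - 1))
    ((((v⁻¹ : 𝔸ˣ) : 𝔸) - 1) * X * ((v : 𝔸) - 1))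
  have t4 := norm_add_le (((u : 𝔸) - v) * X - X * ((u : 𝔸) - v)) (((u : 𝔸) - 1) * X * (((u⁻¹ : 𝔸ˣ) : 𝔸) - 1))
  have t5 := norm_sub_le (((u : 𝔸) - v) * X) (X * ((u : 𝔸) - v))
  nlinarith [hA, hB, hC, hD, hE, hF, t1, t2, t3, t4, t5, norm_nonneg X, sq_nonneg ε]

variable (φA : W ≃ₗ[ℂ] 𝔸) {Mφ Mφ' : ℝ} (hφ : ∀ w, ‖φA w‖ ≤ Mφ * ‖w‖) (hφ' : ∀ X, ‖φA.symm X‖ ≤ Mφ' * ‖X‖) (hMφ' : 0 ≤ Mφ')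

include hφ hφ' hMφ' in
/-- **(ε₂) ON THE FIBRE**: for a unit-type field (`U(b) ∈ U1`) in the bond window `‖U(b) − 1‖ ≤ ε`,
`‖(R(U(b′)⁻¹)w − w) + (R(U(b))w − w)‖ ≤ M_φ′M_φ(2‖U(b) − U(b′)‖ + 4ε²)‖w‖` — at `b′ = (x − e_μ, μ)`, `b = (x, μ)` the `h2` letter of §2 from the
COLLINEAR-BOND letter `‖U(x, μ) − U(x − e_μ, μ)‖`. [cite: Balaban1985BackgroundPropagators, (3.35) p.396, p.390] -/
theorem norm_adTransportW_pair_sub_le {Pd : Fin d → ℕ} (U : Bond d Pd → 𝔸ˣ) (b b' : Bond d Pd) (hU : U b ∈ B7Prop1Explicit.U1 𝔸)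
    (hU' : U b' ∈ B7Prop1Explicit.U1 𝔸) {ε : ℝ} (hε : ‖(U b : 𝔸) - 1‖ ≤ ε) (hε' : ‖(U b' : 𝔸) - 1‖ ≤ ε) (w : W) :
    ‖(adTransportW φA (fun b => (U b)⁻¹) b' w - w) + (adTransportW φA U b w - w)‖ ≤
      Mφ' * Mφ * (2 * ‖(U b : 𝔸) - U b'‖ + 4 * ε ^ 2) * ‖w‖ := by
  have hsplit : (adTransportW φA (fun b => (U b)⁻¹) b' w - w) + (adTransportW φA U b w - w) =
      φA.symm (((((U b')⁻¹ : 𝔸ˣ) : 𝔸) * φA w * (U b' : 𝔸) - φA w) + ((U b : 𝔸) * φA w * (((U b)⁻¹ : 𝔸ˣ) : 𝔸) - φA w)) := by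
    rw [adTransportW_apply, adTransportW_apply, inv_inv]
    conv_lhs => rw [← φA.symm_apply_apply w]
    simp only [map_sub, map_add, LinearEquiv.apply_symm_apply]
  rw [hsplit]
  have hu' : ‖(((U b)⁻¹ : 𝔸ˣ) : 𝔸) - 1‖ ≤ ε := (B7Prop1Explicit.norm_inv_sub_one_le hU).trans hε
  have hv' : ‖(((U b')⁻¹ : 𝔸ˣ) : 𝔸) - 1‖ ≤ ε := (B7Prop1Explicit.norm_inv_sub_one_le hU').trans hε'
  have hX : ‖φA w‖ ≤ Mφ * ‖w‖ := hφ w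
  have h0 : 0 ≤ 2 * ‖(U b : 𝔸) - U b'‖ + 4 * ε ^ 2 := by positivity
  calc _ ≤ Mφ' * ‖((((U b')⁻¹ : 𝔸ˣ) : 𝔸) * φA w * (U b' : 𝔸) - φA w) + ((U b : 𝔸) * φA w * (((U b)⁻¹ : 𝔸ˣ) : 𝔸) - φA w)‖ := hφ' _
    _ ≤ Mφ' * ((2 * ‖(U b : 𝔸) - U b'‖ + 4 * ε ^ 2) * (Mφ * ‖w‖)) := by
        refine mul_le_mul_of_nonneg_left ?_ hMφ'
        exact (norm_invConj_add_conj_sub_le (U b) (U b') hε hu' hε' hv' (φA w)).trans (mul_le_mul_of_nonneg_left hX h0)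
    _ = Mφ' * Mφ * (2 * ‖(U b : 𝔸) - U b'‖ + 4 * ε ^ 2) * ‖w‖ := by ring

end Letters

/-! ## §4 The package at the unit windows: ONE new displayed letter, the collinear-bond letter -/

section UnitWindow

variable {𝔸 : Type*} [NormedRing 𝔸] [NormedAlgebra ℂ 𝔸] [NormOneClass 𝔸]
  {c₀ c₁ : ℝ} [Fact (0 < c₀)] [Fact (0 < c₁)]

/-- **THE BUMP SECTION AT A UNIT-TYPE BACKGROUND IN THE BOND WINDOW, WITH THE COLLINEAR-BOND LETTER DISPLAYED**: for `L ≥ 3`, `Lη = 1`, `c₁ = c₀L^d`, a fibre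
reading `φ_A` with `‖φ_A w‖ ≤ M_φ‖w‖`, `‖φ_A⁻¹X‖ ≤ M_φ′‖X‖`, a field with `U(b) ∈ U1`, `‖U(b) − 1‖ ≤ ε` (the letters of `B9Eq387IMSAssemblyLattice`) and the ONE
new letter `‖U(x, μ) − U(x − e_μ, μ)‖ ≤ β₂` (collinear bonds; print's `|∇^ηA|η²` in the gauge of (3.35)), in the window `3^d·ρ′(2M_φM_φ′ε) < 1`: `∃ Ψ_U` linear,
`Q′(U)(Ψ_Ug) = g`, block-local (`g(y) = 0 ⇒ Ψ_Ug = 0` on `B(y)`), `‖Δ^η_U(Ψ_Ug)‖ ≤ (1 − 3^dρ′)⁻¹·(d(3∕2)^d9π²2^{d−1} + d3^d·L²M_φ′M_φ(2β₂ + 4ε²) + d(3∕2)^d6π2^{d−1}·L·2M_φM_φ′ε)·‖g‖` — on the proper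
scale (`ε = αη`, `β₂ = βη²`, `Lη = 1`) every `L` cancels. [cite: Balaban1985BackgroundPropagators, (3.19) p.393, (3.23) p.394, (3.35) p.396, Cor 3.6 p.408, (3.89) p.409] -/
theorem exists_bump_section_background_unitWindow [∀ i, NeZero (fineP L m i)] [FiniteDimensional ℂ W] (hL : 3 ≤ L) {η : ℝ}
    (hLη : (L : ℝ) * η = 1) (hc : c₀ * (L : ℝ) ^ d = c₁) (φA : W ≃ₗ[ℂ] 𝔸) {Mφ Mφ' : ℝ} (hMφ : 0 ≤ Mφ) (hφ : ∀ w, ‖φA w‖ ≤ Mφ * ‖w‖)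
    (hMφ' : 0 ≤ Mφ') (hφ' : ∀ X, ‖φA.symm X‖ ≤ Mφ' * ‖X‖) (U : Bond d (fineP L m) → 𝔸ˣ) (hU1 : ∀ b, U b ∈ B7Prop1Explicit.U1 𝔸)
    {ε β₂ : ℝ} (hε : 0 ≤ ε) (hUε : ∀ b, ‖(U b : 𝔸) - 1‖ ≤ ε) (hβ : 0 ≤ β₂)
    (hcol : ∀ (y : TSite d (fineP L m)) (μ : Fin d), ‖(U (y, μ) : 𝔸) - U (unshift μ y, μ)‖ ≤ β₂)
    (hq : 3 ^ d * ((1 + 2 * Mφ * Mφ' * ε) ^ (d * (L - 1)) - 1) < 1) :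
    ∃ ΨU : SiteL2K ℂ d m c₁ W →ₗ[ℂ] SiteL2K ℂ d (fineP L m) c₀ W,
      (∀ (g : SiteL2K ℂ d m c₁ W) (y : TSite d m), QprimeW L m φA U (c₀ := c₀) (ΨU g) y = WL2.equiv ℂ _ W g y) ∧
      (∀ (g : SiteL2K ℂ d m c₁ W) (y : TSite d m), WL2.equiv ℂ _ W g y = 0 →
          ∀ x : TSite d (fineP L m), blockCoord L m x = y → WL2.equiv ℂ _ W (ΨU g) x = 0) ∧
      (∀ g : SiteL2K ℂ d m c₁ W,
          ‖covLaplaceSiteK ((η : ℂ))⁻¹ (adTransportW φA U) (adTransportW φA (fun b => (U b)⁻¹)) (ΨU g)‖ ≤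
            (1 - 3 ^ d * ((1 + 2 * Mφ * Mφ' * ε) ^ (d * (L - 1)) - 1))⁻¹ *
              (d * (3 / 2 : ℝ) ^ d * (9 * Real.pi ^ 2) * 2 ^ (d - 1) + d * 3 ^ d * ((L : ℝ) ^ 2 * (Mφ' * Mφ * (2 * β₂ + 4 * ε ^ 2))) +
                d * (3 / 2 : ℝ) ^ d * (6 * Real.pi) * 2 ^ (d - 1) * ((L : ℝ) * (2 * Mφ * Mφ' * ε))) * ‖g‖) := by
  have hR1 : ∀ b w, ‖adTransportW φA U b w - w‖ ≤ 2 * Mφ * Mφ' * ε * ‖w‖ := fun b w =>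
    B9Eq384RemainderLetters.norm_adTransportW_sub_le φA hφ hφ' hMφ' U b (hU1 b) (hUε b) w
  have hS1 : ∀ b w, ‖adTransportW φA (fun b => (U b)⁻¹) b w - w‖ ≤ 2 * Mφ * Mφ' * ε * ‖w‖ := fun b w =>
    B9Eq384RemainderLetters.norm_adTransportW_sub_le φA hφ hφ' hMφ' (fun b => (U b)⁻¹) b (inv_mem (hU1 b))
      ((B7Prop1Explicit.norm_inv_sub_one_le (hU1 b)).trans (hUε b)) w
  have h2 : ∀ (y : TSite d (fineP L m)) (μ : Fin d) (w : W),
      ‖(adTransportW φA (fun b => (U b)⁻¹) (unshift μ y, μ) w - w) + (adTransportW φA U (y, μ) w - w)‖ ≤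
        Mφ' * Mφ * (2 * β₂ + 4 * ε ^ 2) * ‖w‖ := fun y μ w => by
    refine (norm_adTransportW_pair_sub_le φA hφ hφ' hMφ' U (y, μ) (unshift μ y, μ) (hU1 _) (hU1 _) (hUε _) (hUε _) w).trans ?_
    have h := hcol y μ
    gcongr
  exact exists_bump_section_background L m hL hLη hc φA U (by positivity) (by positivity) hR1 hS1 h2 hq

end UnitWindow

end Literature.MathematicalPhysics.QuantumFieldTheory.Balaban1983to89.B9Eq319BumpSectionBackgroundExact

end
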